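import Summits.QuantumFields.BalabanUV.Beta.FP.SymmetryKSlot

/-!
# `BalabanUV.Beta.FP.PerfectJetsTranslate` — road «FP» for binder row D1, leaf N3(ii)-S/W (TRANSLATION HALF) at `m = 1`, UNCONDITIONAL: the perfect
# one-step jets of the wall family are BLOCK-TRANSLATION COVARIANT — (St♭) for `SPerfOf sf sm S 1` from an2's `JsBal0Of_S_translate`, (Wt) for `WPerfOf sf sm Wt 1`
# from the tables' own (Wt) row — and the UNDRESSED perfect triple `(KPerf …1, vertexOfK (KPerf …1) Lc (SPerfOf …1), WPerfOf …1)` is `BlockCovariant` at blocking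
# `Lc`, ANY units, NO (CONV-C) input (the constructed limits need not converge for translation covariance: `SymmetryK.translate_limStOf` / `_limTabOf` are
# unconditional)

HONEST FRAMING (cell contract, verbatim): «discharging `BetaPertH` makes Bałaban's UV stability UNCONDITIONAL — a real constructive-QFT result; it is NOT the
continuum limit and NOT the Clay problem.»  THIS MODULE DISCHARGES NOTHING of the wall: it composes BY NAME `BalabanStepJetsSucc.JsBal0Of_S_translate` (an2),
`vertexOfK_translate_block` (an2), `FP.SymmetryK.translate_limStOf` / `translate_limTabOf` / `unitS_translate` / `unitW_translate`, `SymmetryKSlot.shiftK_KPerf_one`,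
`PerfectObjectsT.SPerfOf_one` / `WPerfOf_one`.  The REFLECTION half (Sr)/(Wr) of N3(ii)-S/W is NOT here (the wall family's stencils obey it only in conjugated
form, an2's (L3)/(L4)); the (Wt) row of the tables `W j` is a HYPOTHESIS (`hWt`, as everywhere in the tree).  Claim table `HOME/b2b-balaban-beta-d1-p3/LEAVES-FP.md`
row N3(ii)–(iv) (unit `b2b-balaban-beta-d1-formalise-leaf-06`).  NOT BetaPertH, NOT continuum, NOT Clay.
ABSOLUTE RULE (cell, verbatim): «No internally-minted statement may enter as a cited fact. Every hypothesis is either kernel-proved in this package or a verbatim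
quotation of a PUBLISHED theorem with page reference.»  Nothing is cited; no `def … : Prop`.

CONTENT (all [our object]; any `d`-free? — `d = 3` where the wall family lives; any `Lc ≥ 1`, any unit sequences):
**`SPerfOf_one_translate`** ((St♭) of the perfect stencils, 0 hypotheses beyond the pin `hS1`), **`WPerfOf_one_translate`** ((Wt) of the perfect tables from `hWt` + pin `hW1`),
**`vertexOfK_KPerf_one_translate`**, **`blockCovariant_perfect_one`** (`ExpKernelCalculus.BlockCovariant` of the undressed perfect triple at blocking `Lc`).
-/

namespace Summit.QuantumFields.BalabanUV.Beta.FP.PerfectJetsTranslate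

open Filter Topology
open Literature.MathematicalPhysics.QuantumFieldTheory.Balaban1983to89
open Literature.MathematicalPhysics.QuantumFieldTheory.Balaban1983to89.Beta
open ExpKernelCalculus (MKer VertexFamily₂ shiftK BlockCovariant)
open OneStepResolventKernel (Fib)
open OneStepKernelFamily (vertexOfK)
open BalabanStepJetsSucc (JsBal0Of JsBal0Of_S_translate vertexOfK_translate_block)
open HessKerDressedLimit (limStOf limTabOf)
open Summit.QuantumFields.BalabanUV.Beta.HessKerDressedUnits (unitS unitW)
open Summit.QuantumFields.BalabanUV.Beta.FP.PerfectObjectsT (KPerf SPerfOf SPerfOf_one WPerfOf WPerfOf_one)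
open Summit.QuantumFields.BalabanUV.Beta.FP.SymmetryK (translate_limStOf translate_limTabOf unitS_translate unitW_translate)
open Summit.QuantumFields.BalabanUV.Beta.FP.SymmetryKSlot (shiftK_KPerf_one)

noncomputable section

variable {Lc : ℕ} [NeZero Lc] (hLc : 1 ≤ Lc) (cE cVH cΛ : ℝ)
  (W : ℕ → Fin (3 + 1) → (Fin (3 + 1) → ℤ) → Fin (3 + 1) → (Fin (3 + 1) → ℤ) → MKer (3 + 1) (Fib 3))
  (Cw' δw : ℕ → ℝ) (hδw : ∀ j, 0 < δw j) (hW' : ∀ j, VertexFamily₂ (W j) Lc (Cw' j) (δw j))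
  (sf sm : ℕ → ℝ)
  (S : ℕ → ℕ → Fin (3 + 1) → (Fin (3 + 1) → ℤ) → MKer (3 + 1) (Fib 3))
  (Wt : ℕ → ℕ → Fin (3 + 1) → (Fin (3 + 1) → ℤ) → Fin (3 + 1) → (Fin (3 + 1) → ℤ) → MKer (3 + 1) (Fib 3))

/-- **(St♭) OF THE PERFECT ONE-STEP STENCILS — UNCONDITIONAL**: for the wall family (pin `hS1`) and ANY unit sequences,
`SPerfOf sf sm S 1 κ′ (u + Lc•t) = shiftK (−Lc•t) (SPerfOf sf sm S 1 κ′ u)` — an2's `JsBal0Of_S_translate` member by member, through the units (`unitS_translate`) and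
the constructed limit (`translate_limStOf`, no convergence needed). [our object] -/
theorem SPerfOf_one_translate (hS1 : ∀ j, S j 1 = (JsBal0Of hLc cE cVH cΛ W Cw' δw hδw hW' j).S) (κ' : Fin (3 + 1)) (u t : Fin (3 + 1) → ℤ) :
    SPerfOf sf sm S 1 κ' (u + (Lc : ℤ) • t) = shiftK (-((Lc : ℤ) • t)) (SPerfOf sf sm S 1 κ' u) := by
  rw [SPerfOf_one sf sm hS1]
  exact translate_limStOf (S := fun j => unitS (sf j) (sm j) (JsBal0Of hLc cE cVH cΛ W Cw' δw hδw hW' j).S)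
    (fun j κ'' u' => unitS_translate (fun κ₀ u₀ => JsBal0Of_S_translate hLc cE cVH cΛ W Cw' δw hδw hW' j κ₀ u₀ t) (sf j) (sm j) κ'' u') κ' u

omit [NeZero Lc] in
/-- **(Wt) OF THE PERFECT ONE-STEP TABLES** from the tables' own (Wt) row (pin `hW1`), ANY units — `unitW_translate` + `translate_limTabOf` (unconditional). [our object] -/
theorem WPerfOf_one_translate
    (hWt : ∀ (j : ℕ) (μ : Fin (3 + 1)) (y : Fin (3 + 1) → ℤ) (ν : Fin (3 + 1)) (y' t : Fin (3 + 1) → ℤ),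
      W j μ (y + t) ν (y' + t) = shiftK (-((Lc : ℤ) • t)) (W j μ y ν y'))
    (hW1 : ∀ j, Wt j 1 = W j) (μ : Fin (3 + 1)) (y : Fin (3 + 1) → ℤ) (ν : Fin (3 + 1)) (y' t : Fin (3 + 1) → ℤ) :
    WPerfOf sf sm Wt 1 μ (y + t) ν (y' + t) = shiftK (-((Lc : ℤ) • t)) (WPerfOf sf sm Wt 1 μ y ν y') := by
  rw [WPerfOf_one sf sm hW1]
  exact translate_limTabOf (W := fun j => unitW (sf j) (sm j) (W j))
    (fun j μ₀ y₀ ν₀ y₀' => unitW_translate (fun μ₁ y₁ ν₁ y₁' => hWt j μ₁ y₁ ν₁ y₁' t) (sf j) (sm j) μ₀ y₀ ν₀ y₀') μ y ν y'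

/-- **BLOCK COVARIANCE OF THE PERFECT CHAIN-RULE VERTEX — UNCONDITIONAL**: `vertexOfK (KPerf …1) Lc (SPerfOf …1) μ (y + t) = shiftK (−Lc•t) (… μ y)`
(an2's `vertexOfK_translate_block` with `shiftK_KPerf_one` and `SPerfOf_one_translate`). [our object] -/
theorem vertexOfK_KPerf_one_translate (hS1 : ∀ j, S j 1 = (JsBal0Of hLc cE cVH cΛ W Cw' δw hδw hW' j).S) (μ : Fin (3 + 1))
    (y t : Fin (3 + 1) → ℤ) :
    vertexOfK (KPerf (d := 3) Lc sf sm 1) Lc (SPerfOf sf sm S 1) μ (y + t) =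
      shiftK (-((Lc : ℤ) • t)) (vertexOfK (KPerf (d := 3) Lc sf sm 1) Lc (SPerfOf sf sm S 1) μ y) :=
  vertexOfK_translate_block (shiftK_KPerf_one (d := 3) Lc sf sm) (SPerfOf_one_translate hLc cE cVH cΛ W Cw' δw hδw hW' sf sm S hS1) μ y t

/-- **THE UNDRESSED PERFECT ONE-STEP TRIPLE IS BLOCK-COVARIANT AT BLOCKING `Lc`** (`ExpKernelCalculus.BlockCovariant`; ANY units; inputs: the pins and the tables'
(Wt) row — NO (CONV-C) hypothesis). [our object] -/
theorem blockCovariant_perfect_one (hS1 : ∀ j, S j 1 = (JsBal0Of hLc cE cVH cΛ W Cw' δw hδw hW' j).S)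
    (hWt : ∀ (j : ℕ) (μ : Fin (3 + 1)) (y : Fin (3 + 1) → ℤ) (ν : Fin (3 + 1)) (y' t : Fin (3 + 1) → ℤ),
      W j μ (y + t) ν (y' + t) = shiftK (-((Lc : ℤ) • t)) (W j μ y ν y'))
    (hW1 : ∀ j, Wt j 1 = W j) :
    BlockCovariant (KPerf (d := 3) Lc sf sm 1) (vertexOfK (KPerf (d := 3) Lc sf sm 1) Lc (SPerfOf sf sm S 1)) (WPerfOf sf sm Wt 1) Lc :=
  ⟨shiftK_KPerf_one (d := 3) Lc sf sm, vertexOfK_KPerf_one_translate hLc cE cVH cΛ W Cw' δw hδw hW' sf sm S hS1,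
    WPerfOf_one_translate W sf sm Wt hWt hW1⟩

end

end Summit.QuantumFields.BalabanUV.Beta.FP.PerfectJetsTranslate
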